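import Summits.CriticalPhenomena.CardyFormulaZ2.Theorems.CardyMagicRigidityNestingRigidityTomographyVocab
import HarnessLib

/-!
# The multi-scale selection rule of neck tomography and robust hulls of context events

Crux `Summit.CriticalPhenomena.CardyFormulaZ2.Theses.CardyMagicRigidity.NestingRigidity` (stmt-CriticalPhenomena-4835),
line `pinch-resampling` v4, stub S10' `stub_neckTomographyV4` (`FiveArmUpperT → FiveArmUpperZ2 → NoNeckRigidity →
NeckHookupCoarseT → NeckHookupCoarseZ2 → LoopLimitZ2Blind → LoopLimitZ2EqT`); companion of the vocabulary module
`…NestingRigidityTomographyVocab` (p160054).  Typing note `S10p-typing-v2.md`, item A2 (region selection):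

* `tScale s₀ J ω x` — **the multi-scale radius map**: the largest dyadic radius `s₀ 2^j`, `j < J`, at which the collar of
  `x` is clean (`TPinch x x s s`), `0` if none (then `x` is not selected, `mem_tSel_tScale_iff`).  WHY: with ONE
  prescribed radius the selection event fails at a neck with probability bounded away from `0` at every scale (a
  mesoscopic loop crossing the collar, or a second neck of the same two strands inside the collar — necks of two
  touching macroscopic loops form a set of dimension `3/4`), so the transfer must offer `J ≈ log₂(θ/r) → ∞` scales per
  centre; "no clean scale at some neck of the window" is the good event G6.
* `tScale_eq_iff_of_agree_off` (registered anchor) — **the stopping property**: `{tScale = s₀ 2^j}` reads only the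
  sites off `Λ_{s₀ 2^j}(x)` (clean at `j`, not clean at the larger scales; collars at scales `≥ j` lie outside the ball).
  This is the joint-measurability item T1 for the centre itself.  ACROSS centres it fails for the naive rule: the
  candidate collars of a neighbouring grid centre at larger scales meet `Λ_{s₀ 2^j}(x)`, so the context events of the
  identification step (selection elsewhere, pinned unambiguity) are not exterior-determined for `x` as they stand;
* `robustOff K E` — **the robust hull** `{ω | every modification of ω inside K lies in E}`: the largest sub-event of `E`
  determined off `K` (`robustOff_determinedBy`, `robustOff_subset`, `robustOff_eq_self_of_determinedBy`).  The remedy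
  for T1: condition on the robust hulls of the context events (exterior-determined by construction) and put
  "`E` but not robustly `E`" (a near-degenerate geometry: another candidate collar inside `Λ_s(x)` changes the glued
  structure) into the good events.

* §2 the two PLANAR inputs of D1 on `𝕋` as named statements for later cuts (not asserted, not used as hypotheses):
  `TDiscDuality` (closed dictionary / exactly one hook-up) and `TSwitchPlanar` (the planarity axiom of
  `…NestingRigidityBlobGraph` instantiated for the lattice germs), each with its truth argument.

Sorry-free; the probabilistic content of G6 is NOT here (typing note v2, A2: it needs a decorated four-arm bound with
exponent `> 2`, see there).
-/

noncomputable section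

namespace Summit.CriticalPhenomena.CardyFormulaZ2.Cruxes.NestingRigidity.PinchResampling

open Summit.CriticalPhenomena.CardyFormulaZ2.Theses.CardyMagicRigidity
open MeasureTheory Set Relation Literature.Probability.Percolation Literature.Probability.LatticeModels
  Literature.Probability.RandomPlanarGeometry

/-! ## §1 The multi-scale selection rule and robust hulls -/

section MultiScale

open Classical in
/-- **The multi-scale radius map (typing note v2, A2).**  At the centre `x`, among the dyadic radii `s₀ 2^j`, `j < J`,
the LARGEST one at which the collar `Λ_{2s}(x) ∖ Λ_s(x)` is clean (`TPinch x x s s`: exactly two open and two closed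
crossing clusters), and `0` if there is none (then `x` is not selected: `TPinch x x 0 0 = ∅`).  A single prescribed radius
fails at a neck with probability bounded away from `0` (a mesoscopic loop or a second neck in the collar); offering
`J ≈ log₂(θ/r)` scales makes "no clean scale at a neck" a rare event (G6, RSW separation scale by scale). -/
def tScale (s₀ J : ℕ) (ω : SiteConfig (Site 2)) (x : Site 2) : ℕ :=
  if ∃ j < J, ω ∈ TPinch x x (s₀ * 2 ^ j) (s₀ * 2 ^ j) then
    s₀ * 2 ^ Nat.findGreatest (fun j ↦ ω ∈ TPinch x x (s₀ * 2 ^ j) (s₀ * 2 ^ j)) (J - 1)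
  else 0

/-- Cleanliness at a dyadic scale `≥ s₀ 2^j` reads only sites off `Λ_{s₀ 2^j}(x)`. -/
theorem tPinch_iff_of_agree_off_of_le {s₀ : ℕ} {x : Site 2} {j k : ℕ} (hjk : j ≤ k)
    {ω ω' : SiteConfig (Site 2)} (h : ω ∩ (tBall x (s₀ * 2 ^ j))ᶜ = ω' ∩ (tBall x (s₀ * 2 ^ j))ᶜ) :
    ω ∈ TPinch x x (s₀ * 2 ^ k) (s₀ * 2 ^ k) ↔ ω' ∈ TPinch x x (s₀ * 2 ^ k) (s₀ * 2 ^ k) := by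
  refine (determinedBy_iff _ _).1 (tPinch_determinedBy x x (s₀ * 2 ^ k) (s₀ * 2 ^ k)) ω ω'
    (Tomography.inter_eq_of_subset h fun v hv hv' ↦ hv.2 ?_)
  simp only [tBall, mem_setOf_eq] at hv' ⊢
  have : (s₀ * 2 ^ j : ℕ) ≤ s₀ * 2 ^ k := Nat.mul_le_mul_left _ (Nat.pow_le_pow_right (by norm_num) hjk)
  exact hv'.trans (by exact_mod_cast this)

/-- **Stopping property of the multi-scale rule (T1 for the centre itself).**  Whether the selected radius at `x` is
the dyadic radius `s₀ 2^j` (`j < J`, `s₀ ≥ 1`) reads only the sites off `Λ_{s₀ 2^j}(x)`: it says "clean at scale `j`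
and at no larger scale `< J`", and cleanliness at scales `≥ j` reads collars outside `Λ_{s₀ 2^j}(x)`.  (Joint
measurability ACROSS centres is a different matter: the candidate collars of a neighbouring grid centre at larger
scales meet `Λ_{s₀ 2^j}(x)`; the remedy is `robustOff` below plus a good event, typing note v2 A2.) -/
theorem tScale_eq_iff_of_agree_off : ∀ {s₀ J : ℕ}, 1 ≤ s₀ → ∀ {x : Site 2} {j : ℕ}, j < J → ∀ {ω ω' : SiteConfig (Site 2)}, ω ∩ (tBall x (s₀ * 2 ^ j))ᶜ = ω' ∩ (tBall x (s₀ * 2 ^ j))ᶜ → (Summit.CriticalPhenomena.CardyFormulaZ2.Cruxes.NestingRigidity.PinchResampling.tScale s₀ J ω x = s₀ * 2 ^ j ↔ Summit.CriticalPhenomena.CardyFormulaZ2.Cruxes.NestingRigidity.PinchResampling.tScale s₀ J ω' x = s₀ * 2 ^ j) := by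
  intro s₀ J hs₀ x j hj ω ω' h
  classical
  -- both sides are equivalent to "clean at `j`, not clean at any `k` with `j < k < J`"
  have key : ∀ {η : SiteConfig (Site 2)}, tScale s₀ J η x = s₀ * 2 ^ j ↔
      η ∈ TPinch x x (s₀ * 2 ^ j) (s₀ * 2 ^ j) ∧ ∀ k, j < k → k < J → η ∉ TPinch x x (s₀ * 2 ^ k) (s₀ * 2 ^ k) := by
    intro η
    have hinj : ∀ {a b : ℕ}, s₀ * 2 ^ a = s₀ * 2 ^ b ↔ a = b := fun {a b} ↦ by
      constructor
      · intro hab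
        exact Nat.pow_right_injective (le_refl 2) (Nat.eq_of_mul_eq_mul_left (by omega) hab)
      · rintro rfl; rfl
    unfold tScale
    split_ifs with hex
    · rw [hinj, Nat.findGreatest_eq_iff]
      constructor
      · rintro ⟨-, h2, h3⟩
        obtain ⟨j', hj', hω⟩ := hex
        refine ⟨?_, fun k hk hkJ ↦ h3 hk (by omega)⟩
        by_cases hj0 : j = 0
        · -- `j = 0`: the witness `j'` is `0` or is excluded by maximality
          by_cases hj'0 : j' = 0
          · subst hj'0; subst hj0; exact hω
          · exact absurd hω (h3 (by omega) (by omega))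
        · exact h2 hj0
      · rintro ⟨h1, h2⟩
        exact ⟨by omega, fun _ ↦ h1, fun k hk hkJ ↦ h2 k hk (by omega)⟩
    · constructor
      · intro h0
        have : 0 < s₀ * 2 ^ j := Nat.mul_pos (by omega) (Nat.two_pow_pos j)
        omega
      · rintro ⟨h1, -⟩
        exact absurd ⟨j, hj, h1⟩ hex
  rw [key, key, tPinch_iff_of_agree_off_of_le le_rfl h]
  have hk : ∀ k, j < k → (ω ∈ TPinch x x (s₀ * 2 ^ k) (s₀ * 2 ^ k) ↔ ω' ∈ TPinch x x (s₀ * 2 ^ k) (s₀ * 2 ^ k)) :=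
    fun k hk ↦ tPinch_iff_of_agree_off_of_le hk.le h
  exact and_congr_right fun _ ↦ forall_congr' fun k ↦ forall_congr' fun hk' ↦ forall_congr' fun _ ↦ by rw [hk k hk']

/-- With the multi-scale rule a centre is selected iff some dyadic scale is clean (if none is, the radius is `0` and
`TPinch x x 0 0 = ∅`). -/
theorem mem_tSel_tScale_iff (s₀ J : ℕ) (X : Set (Site 2)) (ω : SiteConfig (Site 2)) (x : Site 2) :
    x ∈ tSel (tScale s₀ J ω) X ω ↔ x ∈ X ∧ ∃ j < J, ω ∈ TPinch x x (s₀ * 2 ^ j) (s₀ * 2 ^ j) := by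
  classical
  simp only [tSel, mem_setOf_eq]
  refine and_congr_right fun _ ↦ ⟨fun h ↦ ?_, fun h ↦ ?_⟩
  · by_contra hex
    rw [tScale, if_neg hex, tPinch_eq_empty_of_zero (by simp)] at h
    exact h
  · rw [tScale, if_pos h]
    obtain ⟨j, hj, hω⟩ := h
    exact Nat.findGreatest_spec (P := fun j ↦ ω ∈ TPinch x x (s₀ * 2 ^ j) (s₀ * 2 ^ j)) (Nat.le_sub_one_of_lt hj) hω

/-- **The robust hull of an event off `K`**: the configurations ALL of whose modifications inside `K` lie in `E` — the
largest sub-event of `E` determined by `Kᶜ`.  With configuration-dependent radii the identification step uses the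
robust hulls of its context events (exterior-determined by construction), at the price of the good event "`E` but not
robustly `E`". -/
def robustOff (K : Set (Site 2)) (E : Set (SiteConfig (Site 2))) : Set (SiteConfig (Site 2)) :=
  {ω | ∀ ξ : SiteConfig (Site 2), ξ ∩ K ∪ ω \ K ∈ E}

/-- The robust hull is a sub-event (take `ξ = ω`). -/
theorem robustOff_subset (K : Set (Site 2)) (E : Set (SiteConfig (Site 2))) : robustOff K E ⊆ E := by
  intro ω hω
  have h := hω ω
  rwa [inter_union_sdiff] at h

/-- The robust hull is determined by the coordinates off `K`. -/
theorem robustOff_determinedBy (K : Set (Site 2)) (E : Set (SiteConfig (Site 2))) :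
    DeterminedBy (robustOff K E) Kᶜ := by
  rw [determinedBy_iff]
  intro ω ω' h
  have hdiff : ω \ K = ω' \ K := by rwa [sdiff_eq, sdiff_eq]
  simp only [robustOff, mem_setOf_eq, hdiff]

/-- An event determined off `K` is its own robust hull (so `robustOff K` is idempotent and is the largest such
sub-event). -/
theorem robustOff_eq_self_of_determinedBy {K : Set (Site 2)} {E : Set (SiteConfig (Site 2))}
    (hE : DeterminedBy E Kᶜ) : robustOff K E = E := by
  refine (robustOff_subset K E).antisymm fun ω hω ξ ↦ ?_
  refine ((determinedBy_iff _ _).1 hE _ ω ?_).2 hω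
  rw [← sdiff_eq, ← sdiff_eq, splice_diff]

/-- Monotonicity of the robust hull. -/
theorem robustOff_mono (K : Set (Site 2)) {E E' : Set (SiteConfig (Site 2))} (h : E ⊆ E') :
    robustOff K E ⊆ robustOff K E' := fun _ hω ξ ↦ h (hω ξ)

end MultiScale


/-! ## §2 The two planar inputs of D1 on `𝕋`, as named statements (NOT asserted, not used as hypotheses here) -/

section Planar

/-- **Disc duality at a clean collar** (the planar input of the CLOSED dictionary `tGlue_false_tState_iff_reachable` of
`…NestingRigidityTomographyDictionary`, and of "exactly one hook-up holds"): on the selection event `TPinch x x s s`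
(exactly two open and two closed crossing clusters of `Λ_{2s}(x) ∖ Λ_s(x)`), the open crossings are NOT all joined by an
open path of `Λ_{2s}(x)` iff the closed crossings ARE all joined by a closed path of `Λ_{2s}(x)`.  WHY TRUE: the four
crossing clusters alternate around the annulus (two open clusters are distinct only if closed crossings separate them
on both sides, by the sector form of the Hex lemma); "at least one": if the two open clusters are not joined in the ball,
the closed sites of the ball separate them, and a separating closed path runs from one closed sector through the hole to
the other, joining the two closed clusters (every closed crossing lies in one of them); "at most one": an open chord and
a closed chord of the disc joining alternating boundary pairs cross, and crossing `𝕋`-paths share a site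
(`PathIn.tri_crossings_meet` is the parallelogram case).  Size M–L over the tree's `TriCrossingsMeet`/`TriFaceLabel`
toolkit; `s = 0` is vacuous (`TPinch x x 0 0 = ∅`). -/
def TDiscDuality : Prop :=
  ∀ (ω : SiteConfig (Site 2)) (x : Site 2) (s : ℕ), ω ∈ TPinch x x s s →
    (ω ∉ THook x x s s ↔ HookedUp triGraph (tColourGraph ω false) (tBall x s) (tBall x (2 * s)))

/-- **The switch-planarity instance on `𝕋`** (the planarity axiom of `…NestingRigidityBlobGraph` for the lattice germs;
wave-3 probe `probe_tSwitchPlanar`; typing note v2 A4): for a selected region `x` with pairwise disjoint closed collars,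
open germs `v₁, v₂` in different open crossing clusters of its collar and closed germs `w₁, w₂` in different closed
crossing clusters, it is impossible that `v₁, v₂` are open-glued WITHOUT `x` and `w₁, w₂` closed-glued WITHOUT `x`
(under any hypothetical state vector `b`).  WHY TRUE: realise the open gluing as a `𝕋`-path through open sites off the
interiors and through the interiors of regions `y ≠ x` with `b y = true`, the closed gluing through closed sites off the
interiors and interiors of regions with `b y = false` — vertex-disjoint site sets, both avoiding `Λ_{sc x}(x)`; close the
open route through `Λ_{sc x}(x)` into a lattice loop `J`; inside `Λ_{sc x}(x)` the loop is a single chord between the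
contacts of `v₁` and `v₂`, and by the ALTERNATION of the four crossing clusters around the collar the contacts of `w₁`,
`w₂` lie in different components of the hexagon minus the chord, so a transversal inside the hexagon crosses `J` once:
`w₁`, `w₂` have different winding labels (`TriFaceLabel.cellLabel`), yet the closed route joins them off `J`
(`cellLabel_eq_of_pathIn`) — contradiction.  Fails on a torus; size L. -/
def TSwitchPlanar : Prop :=
  ∀ (sc : Site 2 → ℕ) (X : Set (Site 2)) (ω : SiteConfig (Site 2)) (b : Site 2 → Bool) (x v₁ v₂ w₁ w₂ : Site 2),
    (∀ y ∈ tSel sc X ω, ∀ y' ∈ tSel sc X ω, y ≠ y' → Disjoint (tBall y (2 * sc y)) (tBall y' (2 * sc y'))) →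
    x ∈ tSel sc X ω → TGerm sc ω true x v₁ → TGerm sc ω true x v₂ →
    ¬ PathIn (tColourGraph ω true) (tBall x (2 * sc x) \ tBall x (sc x)) v₁ v₂ →
    TGerm sc ω false x w₁ → TGerm sc ω false x w₂ →
    ¬ PathIn (tColourGraph ω false) (tBall x (2 * sc x) \ tBall x (sc x)) w₁ w₂ →
    ¬ (tGlue sc X ω true (Function.update b x false) v₁ v₂ ∧ tGlue sc X ω false (Function.update b x true) w₁ w₂)

end Planar

end Summit.CriticalPhenomena.CardyFormulaZ2.Cruxes.NestingRigidity.PinchResampling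

end
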